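import Literature.MathematicalPhysics.QuantumLattice.CentreSymmetryConfinementProofs
import Literature.MathematicalPhysics.QuantumFieldTheory.LatticeGaugeDobrushin
import Literature.MathematicalPhysics.QuantumLattice.BalabanRGHaarIterates
import Literature.MathematicalPhysics.QuantumLattice.GaugeGroups
import Mathlib.Analysis.CStarAlgebra.Matrix
import HarnessLib

/-!
# The single-link conditional expectation of a represented link variable is a strict contraction
# (Chatterjee, CMP 385 (2021), Lemma 12.2 — a shorter route)

S. Chatterjee, *A probabilistic mechanism for quark confinement*, CMP **385** (2021) [Chatterjee2021], **Lemma 12.2**: «For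
any edge `e`, let `⟨π(ω_e)⟩'` denote the matrix of conditional expectations of the entries of `π(ω_e)` given
`{ω_u : u ≠ e}`. There is a constant `ε ∈ (0,1)`, depending only on `G`, `β`, `π` and `d`, such that
`‖⟨π(ω_e)⟩'‖_op ≤ 1 − ε`» — for an irreducible unitary `π` acting non-trivially on the centre (so that `π(g₀) = c·1`,
`c ≠ 1`, for some central `g₀`). The printed proof goes through the variance inequality Lemma 12.1. Here a shorter
route, valid for every compact metrisable `G` and every continuous unitary `π` with such a `g₀`: the single-link law
is Haar measure tilted by the one-link Wilson energy (`siteLaw_ymSpecification_eq_tilted_haar`), whose density `w`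
lies in `[a, a⁻¹]`, `a = e^{−2B₀}`, `B₀ = |β| (N + C) 2(d−1)` (`|Re tr ρ(U_p)| ≤ C`); the Haar average of `π`
vanishes (`∫ π dλ = π(g₀) ∫ π dλ = c ∫ π dλ` by left invariance); hence
`⟨π(ω_e)⟩' = ∫ π (w − a) dλ` has operator norm `≤ ∫ (w − a) dλ = 1 − a`.

* `integral_rep_apply_haar_eq_zero` — `∫ π(g)_{ab} dλ(g) = 0`;
* ★ `l2_opNorm_matrixIntegral_rep_le` — `‖γ_{{e}}(π(U_e) | η)‖_op ≤ 1 − e^{−2B₀}` for every link `e` and boundary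
  condition `η` (the `L²` operator norm of `Mathlib.Analysis.CStarAlgebra.Matrix`, scope `Matrix.Norms.L2Operator`).

## References
* S. Chatterjee, CMP 385 (2021), arXiv:2006.16229: §12, Lemma 12.1, Lemma 12.2.
-/

noncomputable section

open MeasureTheory Filter Function Finset
open scoped Topology Matrix.Norms.L2Operator

namespace Literature.MathematicalPhysics.QuantumLattice

open Literature.Probability.LatticeModels
open Literature.Probability.LatticeModels.DobrushinMetric (siteLaw)
open Literature.MathematicalPhysics.QuantumFieldTheory (haarProbability card_plaquettesTouching_singleton_le
  siteLaw_ymSpecification_eq_tilted_haar)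

section SingleLink

variable {d N m : ℕ} {G : Type*} [Group G] [TopologicalSpace G] [IsTopologicalGroup G]
  [CompactSpace G] [MeasurableSpace G] [BorelSpace G] [SecondCountableTopology G] [T2Space G]
  (ρ : G →* Matrix (Fin N) (Fin N) ℂ) (π : G →* Matrix (Fin m) (Fin m) ℂ)

omit [SecondCountableTopology G] [T2Space G] in
/-- **The Haar average of a representation with a central element acting by a scalar `c ≠ 1` vanishes**:
`∫ π(g)_{ab} dλ(g) = 0` — by left invariance `∫ π(g) dλ = ∫ π(g₀ g) dλ = c ∫ π(g) dλ` (the step «`π(g₀)` must be `cI`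
for some `c ≠ 1`» of Chatterjee 2021, Lemma 12.1). [cite: Chatterjee2021, Lemma 12.1 (proof)] -/
theorem integral_rep_apply_haar_eq_zero {g₀ : G} {c : ℂ}
    (hc : π g₀ = c • (1 : Matrix (Fin m) (Fin m) ℂ)) (hc1 : c ≠ 1) (a b : Fin m) :
    ∫ g, π g a b ∂(haarProbability G) = 0 := by
  haveI : Measure.IsMulLeftInvariant (haarProbability G) := by
    unfold QuantumFieldTheory.haarProbability; infer_instance
  have hinv := integral_mul_left_eq_self (μ := haarProbability G) (fun g => π g a b) g₀
  have hmul : ∀ g, π (g₀ * g) a b = c * π g a b := fun g => by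
    rw [map_mul, hc, Matrix.smul_mul, Matrix.one_mul, Matrix.smul_apply, smul_eq_mul]
  simp_rw [hmul, integral_const_mul] at hinv
  have h : (c - 1) * ∫ g, π g a b ∂(haarProbability G) = 0 := by rw [sub_mul, one_mul, hinv, sub_self]
  rcases mul_eq_zero.1 h with h1 | h1
  · exact absurd (sub_eq_zero.1 h1) hc1
  · exact h1

/-- Entries of the entrywise integral (the tree's `matrixIntegral`). [folklore] -/
private theorem matrixIntegral_apply' {X : Type*} [MeasurableSpace X] (μ : Measure X)
    (F : X → Matrix (Fin m) (Fin m) ℂ) (a b : Fin m) : matrixIntegral μ F a b = ∫ x, F x a b ∂μ := rfl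

omit [T2Space G] in
/-- ★ **Chatterjee 2021, Lemma 12.2 (every compact gauge group): the one-link kernel expectation of `π(U_e)` is a
uniform strict contraction.** For continuous `ρ` with `|Re tr ρ(U_p)| ≤ C`, a continuous unitary `π` with a central
`g₀`, `π(g₀) = c·1`, `c ≠ 1`, every `β`, every link `e` and every boundary condition `η`:
`‖γ_{{e}}(π(U_e) | η)‖_op ≤ 1 − e^{−2|β|(N+C)·2(d−1)}` (entrywise kernel expectation, `L²` operator norm).
[cite: Chatterjee2021, Lemma 12.2] -/
theorem l2_opNorm_matrixIntegral_rep_le (hρ : Continuous ρ) {C : ℝ} (hC0 : 0 ≤ C)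
    (hC : ∀ (x : Site d) (i j : Fin d) (U : LGConfig d G), |plaquetteObs ρ x i j U| ≤ C) (β : ℝ)
    (hπ : Continuous π) (hπu : ∀ g, π g ∈ Matrix.unitaryGroup (Fin m) ℂ) {g₀ : G} {c : ℂ}
    (hc : π g₀ = c • (1 : Matrix (Fin m) (Fin m) ℂ)) (hc1 : c ≠ 1) (e : ZdEdge d) (η : LGConfig d G) :
    ‖matrixIntegral (ymSpecification ρ β {e} η) (fun U => π (U e))‖ ≤
      1 - Real.exp (-(2 * (|β| * ((N + C) * (2 * (d - 1 : ℕ) : ℕ))))) := by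
  classical
  -- the single-link law: Haar tilted by the one-link energy
  set φ : G → ℝ := fun g => -β * wilsonBoundaryAction ρ {e} (Function.update η e g) with hφ
  set B₀ : ℝ := |β| * ((N + C) * (2 * (d - 1 : ℕ) : ℕ)) with hB₀
  have hB₀0 : 0 ≤ B₀ := by rw [hB₀]; positivity
  have hφB : ∀ g, |φ g| ≤ B₀ := fun g => by
    simp only [hφ, hB₀]
    rw [abs_mul, abs_neg]
    refine mul_le_mul_of_nonneg_left ?_ (abs_nonneg β)
    refine (abs_wilsonBoundaryAction_le ρ hC {e} _).trans ?_
    have hcard : ((plaquettesTouching ({e} : Finset (ZdEdge d))).card : ℝ) ≤ ((2 * (d - 1 : ℕ) : ℕ) : ℝ) := by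
      exact_mod_cast card_plaquettesTouching_singleton_le e
    exact mul_le_mul_of_nonneg_left hcard (by positivity)
  have hφc : Continuous φ := continuous_const.mul
    ((continuous_wilsonBoundaryAction ρ hρ {e}).comp (continuous_const.update e continuous_id))
  set lam : Measure G := haarProbability G with hlam
  haveI : IsProbabilityMeasure lam := by rw [hlam]; infer_instance
  set Z : ℝ := ∫ g, Real.exp (φ g) ∂lam with hZ
  have hexp_le : ∀ g, Real.exp (φ g) ≤ Real.exp B₀ := fun g => Real.exp_le_exp.2 (abs_le.1 (hφB g)).2
  have hexp_ge : ∀ g, Real.exp (-B₀) ≤ Real.exp (φ g) := fun g => Real.exp_le_exp.2 (abs_le.1 (hφB g)).1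
  have hexpi : Integrable (fun g => Real.exp (φ g)) lam :=
    Integrable.of_bound (Real.continuous_exp.comp hφc).aestronglyMeasurable (Real.exp B₀)
      (ae_of_all _ fun g => by rw [Real.norm_eq_abs, abs_of_pos (Real.exp_pos _)]; exact hexp_le g)
  have hZ_le : Z ≤ Real.exp B₀ := by
    have := integral_mono hexpi (integrable_const _) hexp_le
    simpa using this
  have hZ_ge : Real.exp (-B₀) ≤ Z := by
    have := integral_mono (integrable_const _) hexpi hexp_ge
    simpa using this
  have hZpos : 0 < Z := (Real.exp_pos _).trans_le hZ_ge
  -- the density `w = exp φ / Z ≥ a = e^{−2B₀}`, `∫ w = 1`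
  set w : G → ℝ := fun g => Real.exp (φ g) / Z with hw
  set a : ℝ := Real.exp (-(2 * B₀)) with ha
  have hwa : ∀ g, a ≤ w g := fun g => by
    simp only [hw, ha]
    rw [le_div_iff₀ hZpos]
    calc Real.exp (-(2 * B₀)) * Z ≤ Real.exp (-(2 * B₀)) * Real.exp B₀ :=
          mul_le_mul_of_nonneg_left hZ_le (Real.exp_nonneg _)
      _ = Real.exp (-B₀) := by rw [← Real.exp_add]; congr 1; ring
      _ ≤ Real.exp (φ g) := hexp_ge g
  have hwc : Continuous w := (Real.continuous_exp.comp hφc).div_const _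
  have hwi : Integrable w lam := hexpi.div_const _
  have hw1 : ∫ g, w g ∂lam = 1 := by
    simp only [hw]
    rw [integral_div, ← hZ, div_self hZpos.ne']
  -- entries of the kernel expectation as weighted Haar averages
  set P : Matrix (Fin m) (Fin m) ℂ := matrixIntegral (ymSpecification ρ β {e} η) (fun U => π (U e)) with hP
  have hPab : ∀ a' b' : Fin m, P a' b' = ∫ g, (w g : ℂ) * π g a' b' ∂lam := by
    intro a' b'
    rw [hP, matrixIntegral_apply']
    have hcont : Continuous fun g : G => π g a' b' :=
      (continuous_apply b').comp ((continuous_apply a').comp hπ)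
    have h1 : ∫ U, π (U e) a' b' ∂(ymSpecification ρ β {e} η) = ∫ g, π g a' b' ∂(siteLaw (ymSpecification ρ β) e η) := by
      rw [siteLaw, integral_map (measurable_pi_apply e).aemeasurable hcont.aestronglyMeasurable]
    rw [h1, siteLaw_ymSpecification_eq_tilted_haar ρ hρ β e η, integral_tilted]
    refine integral_congr_ae (ae_of_all _ fun g => ?_)
    simp only [hw, RCLike.real_smul_eq_coe_mul]
    rfl
  -- the vector form: `P v = ∫ (w − a) • π(g) v dλ`
  have hvec : ∀ (g : G) (v : EuclideanSpace ℂ (Fin m)),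
      Matrix.toEuclideanCLM (n := Fin m) (𝕜 := ℂ) (π g) v = WithLp.toLp 2 ((π g).mulVec v.ofLp) := by
    intro g v
    conv_lhs => rw [← WithLp.toLp_ofLp (p := 2) v]
    rw [Matrix.toEuclideanCLM_toLp]
  have hPv : ∀ v : EuclideanSpace ℂ (Fin m), Matrix.toEuclideanCLM (n := Fin m) (𝕜 := ℂ) P v =
      ∫ g, ((w g - a : ℝ) : ℂ) • Matrix.toEuclideanCLM (n := Fin m) (𝕜 := ℂ) (π g) v ∂lam := by
    intro v
    have hFc : Continuous fun g => ((w g - a : ℝ) : ℂ) • Matrix.toEuclideanCLM (n := Fin m) (𝕜 := ℂ) (π g) v := by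
      simp_rw [hvec]
      refine (Complex.continuous_ofReal.comp (hwc.sub continuous_const)).smul ?_
      exact (PiLp.continuous_toLp 2 _).comp (hπ.matrix_mulVec continuous_const)
    have hFi : Integrable (fun g => ((w g - a : ℝ) : ℂ) • Matrix.toEuclideanCLM (n := Fin m) (𝕜 := ℂ) (π g) v) lam :=
      hFc.integrable_of_hasCompactSupport (HasCompactSupport.of_compactSpace _)
    ext i
    rw [← PiLp.proj_apply (𝕜 := ℂ) 2 (fun _ : Fin m => ℂ) i (∫ g, _ ∂lam),
      ← ContinuousLinearMap.integral_comp_comm _ hFi]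
    simp only [PiLp.proj_apply, Matrix.ofLp_toEuclideanCLM, PiLp.smul_apply, smul_eq_mul]
    rw [Matrix.mulVec, dotProduct]
    simp only [hPab]
    -- `Σ_j (∫ w π_{ij}) v_j = ∫ (w − a) Σ_j π_{ij} v_j`, using `∫ π_{ij} dλ = 0`
    have hcont : ∀ j, Continuous fun g => π g i j := fun j =>
      (continuous_apply j).comp ((continuous_apply i).comp hπ)
    have hint : ∀ j, Integrable (fun g => (w g : ℂ) * π g i j) lam := fun j =>
      ((Complex.continuous_ofReal.comp hwc).mul (hcont j)).integrable_of_hasCompactSupport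
        (HasCompactSupport.of_compactSpace _)
    have hint' : ∀ j, Integrable (fun g => π g i j) lam := fun j =>
      (hcont j).integrable_of_hasCompactSupport (HasCompactSupport.of_compactSpace _)
    have hzero : ∀ j, ∫ g, π g i j ∂lam = 0 := fun j => integral_rep_apply_haar_eq_zero π hc hc1 i j
    have hsub : ∀ j, ∫ g, (w g : ℂ) * π g i j ∂lam = ∫ g, ((w g - a : ℝ) : ℂ) * π g i j ∂lam := by
      intro j
      have : ∀ g, ((w g - a : ℝ) : ℂ) * π g i j = (w g : ℂ) * π g i j - (a : ℂ) * π g i j := fun g => by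
        push_cast; ring
      simp_rw [this]
      rw [integral_sub (hint j) ((hint' j).const_mul _), integral_const_mul, hzero j, mul_zero, sub_zero]
    simp_rw [hsub]
    have hfx : ∀ j, Integrable (fun g => ((w g - a : ℝ) : ℂ) * π g i j * v.ofLp j) lam := fun j =>
      (((Complex.continuous_ofReal.comp (hwc.sub continuous_const)).mul (hcont j)).mul
        continuous_const).integrable_of_hasCompactSupport (HasCompactSupport.of_compactSpace _)
    have e1 : (fun g => ((w g - a : ℝ) : ℂ) * (π g).mulVec v.ofLp i) =
        fun g => ∑ j, ((w g - a : ℝ) : ℂ) * π g i j * v.ofLp j := by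
      funext g
      rw [Matrix.mulVec, dotProduct, Finset.mul_sum]
      exact Finset.sum_congr rfl fun j _ => by ring
    rw [e1, integral_finsetSum _ fun j _ => hfx j]
    exact Finset.sum_congr rfl fun j _ => (integral_mul_const _ _).symm
  -- the operator-norm bound
  have ha1 : a ≤ 1 := by
    rw [ha]; exact Real.exp_le_one_iff.2 (by linarith)
  rw [← Matrix.l2_opNorm_toEuclideanCLM]
  refine ContinuousLinearMap.opNorm_le_bound _ (by linarith) fun v => ?_
  rw [hPv v]
  have hunit : ∀ g, ‖Matrix.toEuclideanCLM (n := Fin m) (𝕜 := ℂ) (π g) v‖ ≤ ‖v‖ := fun g => by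
    calc ‖Matrix.toEuclideanCLM (n := Fin m) (𝕜 := ℂ) (π g) v‖
        ≤ ‖Matrix.toEuclideanCLM (n := Fin m) (𝕜 := ℂ) (π g)‖ * ‖v‖ := ContinuousLinearMap.le_opNorm _ _
      _ ≤ 1 * ‖v‖ := by
          refine mul_le_mul_of_nonneg_right ?_ (norm_nonneg _)
          rw [Matrix.l2_opNorm_toEuclideanCLM]
          rcases Nat.eq_zero_or_pos m with hm | hm
          · subst hm
            have : π g = 0 := Subsingleton.elim _ _
            rw [this, norm_zero]; exact zero_le_one
          · haveI : Nonempty (Fin m) := ⟨⟨0, hm⟩⟩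
            exact (CStarRing.norm_of_mem_unitary (hπu g : π g ∈ unitary (Matrix (Fin m) (Fin m) ℂ))).le
      _ = ‖v‖ := one_mul _
  calc ‖∫ g, ((w g - a : ℝ) : ℂ) • Matrix.toEuclideanCLM (n := Fin m) (𝕜 := ℂ) (π g) v ∂lam‖
      ≤ ∫ g, ‖((w g - a : ℝ) : ℂ) • Matrix.toEuclideanCLM (n := Fin m) (𝕜 := ℂ) (π g) v‖ ∂lam :=
        norm_integral_le_integral_norm _
    _ ≤ ∫ g, (w g - a) * ‖v‖ ∂lam := by
        refine integral_mono_of_nonneg (ae_of_all _ fun g => norm_nonneg _)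
          ((hwi.sub (integrable_const a)).mul_const _) (ae_of_all _ fun g => ?_)
        dsimp only
        rw [norm_smul, Complex.norm_real, Real.norm_eq_abs, abs_of_nonneg (by linarith [hwa g])]
        exact mul_le_mul_of_nonneg_left (hunit g) (by linarith [hwa g])
    _ = (1 - a) * ‖v‖ := by
        rw [integral_mul_const, integral_sub hwi (integrable_const a), hw1]
        simp

end SingleLink

end Literature.MathematicalPhysics.QuantumLattice

end
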